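import Summits.Ventures.WeilGRH.TwistedGramCellCheck
import HarnessLib

/-!
# GRH arm (rh-explicit, venture WeilGRH): ROW-SPLIT cell checker for the door-E EVEN sector of the twisted format-C χ-cells

Cell `rh-explicit`, WEIL TRACK — GRH ARM (weil-grh-1 gen8; the door-E even-sector twin of weil-grh-2's `TwistedGramCellCheckRows.lean`,
which splits the door-H even checker `checkCellH` and the odd checker `checkCellO`).  `checkCellE` (`TwistedGramCellCheck.lean`) evaluates
ALL `B × B` entries of an even cell (each a Schur complement over `B₃ − B` far columns) in ONE `decide +kernel`; for the thin principal
cells of the uniform `t = 1` decision (`χ₀` mod `32`: blocks `10 × 150` and up) that single evaluation exceeds the kernel's per-call budget.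
This file splits the work by ROWS without touching the mathematics: `checkCellEHead` is the (cheap) header, `checkCellERows … i₀ n` checks the
rows `i₀ ≤ i < i₀ + n` only (glued by `checkCellERows_append` / `_glue`), and `checkCellE_of_rows` reassembles the ORIGINAL `checkCellE = true`
from the header and a row range `[0, n)`, `n ≥ B` — so the soundness theorem `hSe_of_checkCellE` applies verbatim.  Pure Boolean
bookkeeping; RH/GRH-free; standard axioms.  Reference for the enclosure semantics: R. E. Moore (1966) Ch. 3 [Moore1966].
-/

namespace Summit.Ventures.WeilGRH

namespace TwistedEncl
open Literature.NumberTheory.LFunctions Literature.NumberTheory.LFunctions.Yoshida1992 Encl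
open Literature.Analysis.ValidatedNumerics.NumericsMP

variable {S : ℕ}

/-! ## Even sector (door E) -/

/-- The header conjuncts of `checkCellE` (block shape, positivity of the data, far weights positive).
[cite: Moore1966, Ch. 3 (interval arithmetic: inclusion property)] -/
def checkCellEHead (d : EvenCellData) : Bool :=
  decide (2 ≤ d.B) && decide (2 * d.B ≤ d.B3) && decide (0 < d.θN) && decide (0 < d.θD) && decide (0 < d.d0N) &&
    (List.range (d.B3 - d.B)).all (fun c' ↦ decide (0 < d.wN.getD c' 0))

/-- The rows `i₀ ≤ i < i₀ + n` of the cell check `checkCellE` (entry enclosures only).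
[cite: Moore1966, Ch. 3 (interval arithmetic: inclusion property)] -/
def checkCellERows (S : ℕ) (C : Consts) (εs : List ℤ) (LQ : MI) (tab : List IdxRec) (d : EvenCellData) (c : ℕ) (ρ : ℤ)
    (D : List (List ℤ)) (i0 n : ℕ) : Bool :=
  (List.range' i0 n).all fun i ↦ (List.range d.B).all fun j ↦
    enclCheck S c ρ (PsdDyadic.getMZ D i j) (cellE S C εs LQ tab d i j)

/-- Semantics of a row range. [cite: Moore1966, Ch. 3 (interval arithmetic: inclusion property)] -/
theorem checkCellERows_iff {C : Consts} {εs : List ℤ} {LQ : MI} {tab : List IdxRec} {d : EvenCellData} {c : ℕ} {ρ : ℤ}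
    {D : List (List ℤ)} {i0 n : ℕ} :
    checkCellERows S C εs LQ tab d c ρ D i0 n = true ↔
      ∀ i, i0 ≤ i → i < i0 + n → ∀ j < d.B, enclCheck S c ρ (PsdDyadic.getMZ D i j) (cellE S C εs LQ tab d i j) = true := by
  unfold checkCellERows
  simp only [List.all_eq_true, List.mem_range'_1, List.mem_range, and_imp]

/-- Consecutive row ranges glue. [cite: Moore1966, Ch. 3 (interval arithmetic: inclusion property)] -/
theorem checkCellERows_append {C : Consts} {εs : List ℤ} {LQ : MI} {tab : List IdxRec} {d : EvenCellData} {c : ℕ} {ρ : ℤ}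
    {D : List (List ℤ)} {i0 n1 n2 : ℕ} (h1 : checkCellERows S C εs LQ tab d c ρ D i0 n1 = true)
    (h2 : checkCellERows S C εs LQ tab d c ρ D (i0 + n1) n2 = true) :
    checkCellERows S C εs LQ tab d c ρ D i0 (n1 + n2) = true := by
  rw [checkCellERows_iff] at h1 h2 ⊢
  intro i hi1 hi2 j hj
  by_cases h : i < i0 + n1
  · exact h1 i hi1 h j hj
  · exact h2 i (by omega) (by omega) j hj

/-- Consecutive row ranges glue — all indices literal. [folklore] -/
theorem checkCellERows_glue {C : Consts} {εs : List ℤ} {LQ : MI} {tab : List IdxRec} {d : EvenCellData} {c : ℕ} {ρ : ℤ}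
    {D : List (List ℤ)} {i0 n1 i1 n2 n : ℕ} (h1 : checkCellERows S C εs LQ tab d c ρ D i0 n1 = true)
    (h2 : checkCellERows S C εs LQ tab d c ρ D i1 n2 = true) (hi : i1 = i0 + n1) (hn : n = n1 + n2) :
    checkCellERows S C εs LQ tab d c ρ D i0 n = true := by
  subst hi hn; exact checkCellERows_append h1 h2

/-- ★ Reassembly: the header and the full row range `[0, B)` give back `checkCellE = true` (so `hSe_of_checkCellE` applies
verbatim). [cite: Moore1966, Ch. 3 (interval arithmetic: inclusion property)] -/
theorem checkCellE_of_rows {C : Consts} {εs : List ℤ} {LQ : MI} {tab : List IdxRec} {d : EvenCellData} {c : ℕ} {ρ : ℤ}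
    {D : List (List ℤ)} {n : ℕ} (hh : checkCellEHead d = true) (hr : checkCellERows S C εs LQ tab d c ρ D 0 n = true)
    (hn : d.B ≤ n) : checkCellE S C εs LQ tab d c ρ D = true := by
  rw [checkCellERows_iff] at hr
  unfold checkCellEHead at hh
  unfold checkCellE
  simp only [Bool.and_eq_true, decide_eq_true_eq, List.all_eq_true, List.mem_range] at hh ⊢
  exact ⟨hh, fun i hi j hj ↦ hr i (Nat.zero_le i) (by omega) j hj⟩

end TwistedEncl

end Summit.Ventures.WeilGRH
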